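import Literature.Topology.FourManifolds.BandSum
import Literature.Topology.FourManifolds.BandSumProofs
import Literature.Topology.FourManifolds.KnotArcLift
import HarnessLib

/-!
# Commutativity of the connected sum of knots: discharge of `Knot.IsConnectedSum.comm`

Sibling proof file of `Literature.Topology.FourManifolds.BandSum` (D-0014: the named fact
`def X : Prop` is discharged by `theorem X_holds : X`). It proves

* `Literature.Topology.FourManifolds.Knot.IsConnectedSum.comm_holds` — discharge of
  `Literature.Topology.FourManifolds.Knot.IsConnectedSum.comm`: if `K` is a connected sum
  `K₁ # K₂` in the sense of `BandSum.lean` (a band sum of split isotopic copies `K₁'`, `K₂'` of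
  the factors along a band crossing a splitting sphere `S` in its middle segment), then `K` is a
  connected sum `K₂ # K₁`.

In the printed sources the two factors enter the definition of the product symmetrically
(Cromwell (2004), §4.6: "`L = L₁ # L₂ = (L₁ - a) ∪ (L₂ - c) ∪ b ∪ d`" for a rectangle `R`,
`∂R = a ∪ b ∪ c ∪ d`, on the split link `L₁ ⊔ L₂` with `|R ∩ S| = 1`), so that commutativity is
part of the statement that the oriented knot types form an abelian semigroup under `#`
(Cromwell (2004), Thm. 4.6.2; Burde–Zieschang (2003), §7.A; Rolfsen (1976), §2.G). The
predicate `Knot.IsConnectedSum K₁ K₂ K` of `BandSum.lean` is *oriented* band-sum data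
(`BandData`): `K₁'` runs *up* the left edge of the band square, `K₂'` *down* the right edge, and
`K` runs from left to right along the *lower* planar arc. Exchanging the factors therefore
amounts to precomposing the band with the **half-turn** `x ↦ (1, 1) - x` of the square
(`BandData.exists_halfTurn`), which exchanges the edges with their orientations and the two
planar arcs; every clause of `BandData` transports formally (chain rule with `D = -id`) except
the orientation clause of the result on the new lower arc, i.e. on the *old upper arc*, which
`BandData` does not record. That clause is forced, and proving it is the content of this file:

* `Literature.Topology.FourManifolds.BandData.orient_upper` — if the summands are disjoint, `K`
  traverses the upper arc from the upper-right corner `(1, 1 + δ)` to the upper-left corner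
  `(0, 1 + δ)` (velocity of `K` at `band (upperArc (1/2))` = positive multiple of the image of
  the velocity of `upperArc`).

*Proof of `orient_upper`* (lifting to the parameter line, `KnotArcLift.lean`). The closed arcs
`ℓ = band ∘ lowerArc` and `u = band ∘ upperArc` on `[0, 1]` lie on `K` and lift through the
covering `K ∘ circlePt : ℝ → K(𝕊¹)` to continuous `φ`, `ψ : [0, 1] → ℝ` (`Knot.exists_lift`),
strictly monotone because the open arcs are embedded, and differentiable at `1/2` with
`(ι ∘ ℓ)' (1/2) = φ' (1/2) · (K.curve)' (φ (1/2))` (`Knot.deriv_coe_eq_deriv_lift_smul`). The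
clause `orient_result` says exactly `φ' (1/2) > 0`, so `φ` is increasing
(`BandData.strictMonoOn_lift_lowerArc`). The heart is the circular-order lemma
`Knot.apply_zero_mem_of_lifts` / `Knot.strictMonoOn_of_lifts`: on the parameter line (period `1`)
the window `(φ 0, φ 1)` of `ℓ` has length `≤ 1` (`Knot.lift_one_le`); every parameter maps to
the open lower arc, to the open upper arc, or to `A ∪ B` with `A = range K₁`, `B = range K₂`
closed and disjoint (`preimage_range`, `range_diff`); an integer translate of the closed window
`[ψ 0, ψ 1]` of `u` lies in the complementary segment `[φ 1, φ 0 + 1]` (the two open arcs are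
disjoint and their parameter sets are open); and the initial piece `[φ 1, ψ 0 + k]` of that
segment maps into `A ∪ B`, is connected and starts at `ℓ 1 = band (1, -δ) ∈ B`, hence ends in
`B`: so `u` *starts* in `B` whenever `ψ` is increasing. Applied to the reversed arc, a decreasing
`ψ` would put `u 1 = band (0, 1 + δ)` — a point of `A` — into `B`. Hence `ψ` is increasing,
`ψ' (1/2) ≥ 0`, and `≠ 0` because the arc is immersed (`BandData.fderiv_coe_band_ne_zero`),
which is the clause with `θ = 2π ψ (1/2)`, `c = (2π ψ' (1/2))⁻¹`. No "corner of the square is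
not in the open band" lemma is needed: the corners only enter through closedness of
`range K`, `range K₁`, `range K₂`.

## References

* G. Burde, H. Zieschang, *Knots*, 2nd ed., de Gruyter Studies in Mathematics 5 (2003), §7.A
  (composition of knots; the locator "Prop. 7.10" is the one carried by the statement
  `IsConnectedSum.comm`; the book is not held by the literature store at the time of writing —
  acquisition requested) [BurdeZieschang2003].
* P. R. Cromwell, *Knots and Links*, Cambridge University Press (2004), §4.6 "The product
  operation", Thm. 4.6.2: "`(𝕂, #)` is an abelian semigroup with unit, and unique
  factorisation" (held copy, pp. 88–90) [Cromwell2004].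
* D. Rolfsen, *Knots and Links*, Publish or Perish (1976), §2.G [Rolfsen1976].
* A. Hatcher, *Algebraic Topology* (2002), Prop. 1.30 (path lifting), as used through
  `KnotArcLift.lean`.

## Design notes

* The file declares theorems only (no `def`): the half-turned band-sum data are produced
  existentially (`BandData.exists_halfTurn`, recording the new band `x ↦ band ((1, 1) - x)` and
  the unchanged collar width, which is what the crossing clause of `IsConnectedSum` needs), in
  the style of `BandData.exists_map` (`BandSumProofs.lean`).
* `BandData.exists_halfTurn` and `BandData.orient_upper` are stated for arbitrary `avoid` and
  take disjointness of the summands as a hypothesis (for connected sums it follows from the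
  splitting sphere, `Knot.IsSplit.disjoint_range`; in general it is the named fact
  `Knot.IsBandSum.disjoint_range`).
* The circular-order lemmas are stated for a knot `K`, two arcs `ℓ u : ℝ → 𝕊³` with lifts and
  two abstract closed sets `A`, `B`, so that they can be reused for other coherence statements
  about band sums (e.g. handle slides in `KirbyMoves`).
* No notation is declared: `sphere (0 : EuclideanSpace ℝ (Fin 4)) 1` is the `𝕊 3` of
  `Knots.lean`, `EuclideanSpace ℝ (Fin 2)` the parameter plane `𝔼 2` of `BandSum.lean`.
* No statement of `BandSum.lean` is modified; everything in this file is proved.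
-/

open scoped Manifold ContDiff Topology Real
open Set Function Metric

noncomputable section

namespace Literature.Topology.FourManifolds

/-! ### Circular order of two disjoint arcs on a knot -/

namespace Knot

variable (K : Knot)

/-- **Two disjoint arcs on a knot, both positively lifted, alternate with the two closed sets
between them.** Let `ℓ`, `u : ℝ → 𝕊³` be arcs lying on the knot `K` on `[0, 1]`, with disjoint
open images `ℓ '' (0, 1)`, `u '' (0, 1)`, lifted through `K ∘ circlePt` by continuous `φ`, `ψ`
which are increasing on `(0, 1)`, `ℓ` being injective on `(0, 1)`; let `A`, `B` be disjoint
closed sets such that every point `K (circlePt t)` lies on one of the two open arcs or in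
`A ∪ B`, and suppose `ℓ` *ends* in `B` (`ℓ 1 ∈ B`). Then `u` *starts* in `B` (`u 0 ∈ B`). On the
parameter line (period `1`): the window `(φ 0, φ 1)` of `ℓ` has length `≤ 1`
(`Knot.lift_one_le`); the closed window `[ψ 0, ψ 1]` of `u` misses the (open, disjoint from it on
the interior) parameter set of `ℓ`, so an integer translate of it lies in the complementary
segment `[φ 1, φ 0 + 1]`; and the initial piece `[φ 1, ψ 0 + k]` of that segment maps into
`A ∪ B`, is connected and starts in `B`, hence ends in `B`. [folklore] -/
theorem apply_zero_mem_of_lifts {ℓ u : ℝ → sphere (0 : EuclideanSpace ℝ (Fin 4)) 1} {φ ψ : ℝ → ℝ}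
    {A B : Set (sphere (0 : EuclideanSpace ℝ (Fin 4)) 1)}
    (hφ : ContinuousOn φ (Icc 0 1)) (hψ : ContinuousOn ψ (Icc 0 1))
    (hφℓ : ∀ s ∈ Icc (0 : ℝ) 1, K (circlePt (φ s)) = ℓ s)
    (hψu : ∀ s ∈ Icc (0 : ℝ) 1, K (circlePt (ψ s)) = u s)
    (hφm : StrictMonoOn φ (Ioo 0 1)) (hψm : StrictMonoOn ψ (Ioo 0 1))
    (hℓinj : InjOn ℓ (Ioo 0 1))
    (hA : IsClosed A) (hB : IsClosed B) (hAB : Disjoint A B)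
    (hcover : ∀ t : ℝ, K (circlePt t) ∈ ℓ '' Ioo 0 1 ∪ u '' Ioo 0 1 ∪ (A ∪ B))
    (hdisj : Disjoint (ℓ '' Ioo 0 1) (u '' Ioo 0 1))
    (hℓ1 : ℓ 1 ∈ B) : u 0 ∈ B := by
  -- the parametrisation `t ↦ K (circlePt t)` has period `1`
  have hgc : Continuous fun t : ℝ ↦ K (circlePt t) := K.continuous.comp continuous_circlePt
  have hgper : ∀ (t : ℝ) (m : ℤ), K (circlePt (t + m)) = K (circlePt t) := fun t m ↦ by
    rw [circlePt_add_int]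
  set a := φ 0 with ha
  set bb := φ 1 with hbb
  have hab : a < bb := strictMonoOn_Icc_of_Ioo hφ hφm ⟨le_rfl, zero_le_one⟩ ⟨zero_le_one, le_rfl⟩
    zero_lt_one
  have hba : bb ≤ a + 1 := K.lift_one_le hφ hφm hφℓ hℓinj
  set c₀ := ψ 0 with hc₀
  set d₀ := ψ 1 with hd₀
  have hcd₀ : c₀ < d₀ := strictMonoOn_Icc_of_Ioo hψ hψm ⟨le_rfl, zero_le_one⟩ ⟨zero_le_one, le_rfl⟩
    zero_lt_one
  -- the parameter sets of the two open arcs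
  set TL : Set ℝ := {t | K (circlePt t) ∈ ℓ '' Ioo 0 1} with hTL
  set TU : Set ℝ := {t | K (circlePt t) ∈ u '' Ioo 0 1} with hTU
  have hTLU : Disjoint TL TU := by
    rw [Set.disjoint_left]
    intro t ht ht'
    exact Set.disjoint_left.mp hdisj ht ht'
  have memTL : ∀ t, t ∈ TL ↔ ∃ m : ℤ, t - m ∈ Ioo a bb := fun t ↦
    ⟨fun ht ↦ K.exists_sub_int_mem_Ioo_of_lift hφ hφm hφℓ ht, fun ⟨m, hm⟩ ↦ by
      have h := K.apply_circlePt_mem_image_of_lift hφ hφm hφℓ hm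
      have e : K (circlePt (t - m)) = K (circlePt t) := by
        rw [sub_eq_add_neg, ← Int.cast_neg, hgper]
      show K (circlePt t) ∈ ℓ '' Ioo 0 1
      rwa [e] at h⟩
  have memTU : ∀ t, t ∈ TU ↔ ∃ m : ℤ, t - m ∈ Ioo c₀ d₀ := fun t ↦
    ⟨fun ht ↦ K.exists_sub_int_mem_Ioo_of_lift hψ hψm hψu ht, fun ⟨m, hm⟩ ↦ by
      have h := K.apply_circlePt_mem_image_of_lift hψ hψm hψu hm
      have e : K (circlePt (t - m)) = K (circlePt t) := by
        rw [sub_eq_add_neg, ← Int.cast_neg, hgper]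
      show K (circlePt t) ∈ u '' Ioo 0 1
      rwa [e] at h⟩
  have hTLopen : IsOpen TL := by
    have e : TL = ⋃ m : ℤ, (fun t ↦ t - (m : ℝ)) ⁻¹' Ioo a bb := by
      ext t
      simp only [Set.mem_iUnion, Set.mem_preimage]
      exact memTL t
    rw [e]
    exact isOpen_iUnion fun m ↦ isOpen_Ioo.preimage (by fun_prop)
  -- the closed window `[c₀, d₀]` of `u` misses `TL`
  have hIcc_TL : ∀ t ∈ Icc c₀ d₀, t ∉ TL := by
    have h1 : Ioo c₀ d₀ ⊆ TLᶜ := fun t ht htL ↦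
      Set.disjoint_left.mp hTLU htL ((memTU t).2 ⟨0, by simpa using ht⟩)
    have h2 : Icc c₀ d₀ ⊆ TLᶜ := by
      rw [← closure_Ioo hcd₀.ne]
      exact (hTLopen.isClosed_compl.closure_subset_iff).2 h1
    exact fun t ht ↦ h2 ht
  have hper_TL : ∀ (t : ℝ) (m : ℤ), t + m ∈ TL ↔ t ∈ TL := fun t m ↦ by
    show K (circlePt (t + m)) ∈ ℓ '' Ioo 0 1 ↔ K (circlePt t) ∈ ℓ '' Ioo 0 1
    rw [hgper]
  -- normalise the window of `u` into the segment `[bb, a + 1]`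
  set k : ℤ := ⌈bb - c₀⌉ with hk
  have hk1 : bb ≤ c₀ + k := by have := Int.le_ceil (bb - c₀); linarith
  have hk2 : c₀ + k < bb + 1 := by have := Int.ceil_lt_add_one (bb - c₀); linarith
  set c := c₀ + k with hc
  set d := d₀ + k with hd
  have hcd : c < d := by rw [hc, hd]; linarith
  have hca : c ≤ a + 1 := by
    by_contra! hlt
    have hcTL : c ∈ TL := (memTL c).2 ⟨1, by push_cast; constructor <;> linarith⟩
    rw [hc, hper_TL] at hcTL
    exact hIcc_TL c₀ ⟨le_rfl, hcd₀.le⟩ hcTL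
  have hda : d ≤ a + 1 := by
    by_contra! hlt
    set t := min d ((a + bb) / 2 + 1) with ht
    have ht1 : a + 1 < t := lt_min hlt (by linarith)
    have ht2 : t < bb + 1 := (min_le_right _ _).trans_lt (by linarith)
    have ht3 : c < t := lt_min hcd (by linarith)
    have ht4 : t ≤ d := min_le_left _ _
    have htTL : t ∈ TL := (memTL t).2 ⟨1, by push_cast; constructor <;> linarith⟩
    have htk : t - k ∈ Icc c₀ d₀ := ⟨by rw [hc] at ht3; linarith, by rw [hd] at ht4; linarith⟩
    refine hIcc_TL _ htk ?_
    rwa [sub_eq_add_neg, ← Int.cast_neg, hper_TL]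
  -- the segment `[bb, c]` maps into `A ∪ B`
  have hseg : ∀ t ∈ Icc bb c, K (circlePt t) ∈ A ∪ B := by
    intro t ht
    have h1 : t ∉ TL := fun htL ↦ by
      obtain ⟨m, hm1, hm2⟩ := (memTL t).1 htL
      have hm0 : (0 : ℝ) < m := by linarith [ht.1]
      have hm1' : (1 : ℝ) ≤ m := by exact_mod_cast (show (1 : ℤ) ≤ m by exact_mod_cast hm0)
      linarith [ht.2]
    have h2 : t ∉ TU := fun htU ↦ by
      obtain ⟨m, hm1, hm2⟩ := (memTU t).1 htU
      have hkm0 : (0 : ℝ) < k - m := by rw [hc] at ht; linarith [ht.2]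
      have hkm1 : (1 : ℝ) ≤ k - m := by
        exact_mod_cast (show (1 : ℤ) ≤ k - m by exact_mod_cast hkm0)
      rw [hd] at hda
      linarith [ht.1]
    have h := hcover t
    simp only [Set.mem_union] at h
    rcases h with (h | h) | h
    · exact absurd h h1
    · exact absurd h h2
    · exact h
  -- it is connected and starts in `B`, so it ends in `B`
  have hbc : bb ≤ c := hk1
  have hpre := (isPreconnected_iff_subset_of_disjoint_closed.1
    (isPreconnected_Icc (a := bb) (b := c))) ((fun t ↦ K (circlePt t)) ⁻¹' A)
    ((fun t ↦ K (circlePt t)) ⁻¹' B) (hA.preimage hgc) (hB.preimage hgc) (fun t ht ↦ hseg t ht) (by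
      ext t
      simp only [Set.mem_inter_iff, Set.mem_preimage, Set.mem_empty_iff_false, iff_false, not_and]
      exact fun _ htA htB ↦ Set.disjoint_left.mp hAB htA htB)
  have hbbB : K (circlePt bb) ∈ B := by rw [hbb, hφℓ 1 ⟨zero_le_one, le_rfl⟩]; exact hℓ1
  have hsub : Icc bb c ⊆ (fun t ↦ K (circlePt t)) ⁻¹' B := by
    rcases hpre with h | h
    · exact absurd (h ⟨le_rfl, hbc⟩) (Set.disjoint_right.mp hAB hbbB)
    · exact h
  have hcB : K (circlePt c) ∈ B := hsub ⟨hbc, le_rfl⟩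
  rw [hc, hgper, hc₀, hψu 0 ⟨le_rfl, zero_le_one⟩] at hcB
  exact hcB

/-- **Coherent orientation of two arcs on a knot.** In the situation of
`apply_zero_mem_of_lifts`, but with the lift `ψ` of the second arc `u` only known to be strictly
monotone (as it is when `u` is injective on `(0, 1)`), if `u` *ends* in `A` (`u 1 ∈ A`) then `ψ`
is increasing: otherwise the reversed arc `s ↦ u (1 - s)` has the increasing lift
`s ↦ ψ (1 - s)` and starts at `u 1`, which would then lie in `B` as well. [folklore] -/
theorem strictMonoOn_of_lifts {ℓ u : ℝ → sphere (0 : EuclideanSpace ℝ (Fin 4)) 1} {φ ψ : ℝ → ℝ}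
    {A B : Set (sphere (0 : EuclideanSpace ℝ (Fin 4)) 1)}
    (hφ : ContinuousOn φ (Icc 0 1)) (hψ : ContinuousOn ψ (Icc 0 1))
    (hφℓ : ∀ s ∈ Icc (0 : ℝ) 1, K (circlePt (φ s)) = ℓ s)
    (hψu : ∀ s ∈ Icc (0 : ℝ) 1, K (circlePt (ψ s)) = u s)
    (hφm : StrictMonoOn φ (Ioo 0 1)) (hψm : StrictMonoOn ψ (Ioo 0 1) ∨ StrictAntiOn ψ (Ioo 0 1))
    (hℓinj : InjOn ℓ (Ioo 0 1))
    (hA : IsClosed A) (hB : IsClosed B) (hAB : Disjoint A B)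
    (hcover : ∀ t : ℝ, K (circlePt t) ∈ ℓ '' Ioo 0 1 ∪ u '' Ioo 0 1 ∪ (A ∪ B))
    (hdisj : Disjoint (ℓ '' Ioo 0 1) (u '' Ioo 0 1))
    (hℓ1 : ℓ 1 ∈ B) (hu1 : u 1 ∈ A) : StrictMonoOn ψ (Ioo 0 1) := by
  refine hψm.resolve_right fun hanti ↦ ?_
  have himage : (fun s : ℝ ↦ u (1 - s)) '' Ioo 0 1 = u '' Ioo 0 1 := by
    rw [← Set.image_image u (fun s : ℝ ↦ 1 - s), Set.image_const_sub_Ioo]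
    norm_num
  have hmaps : MapsTo (fun s : ℝ ↦ 1 - s) (Icc 0 1) (Icc 0 1) := fun s hs ↦
    ⟨by linarith [hs.2], by linarith [hs.1]⟩
  have h := K.apply_zero_mem_of_lifts (ℓ := ℓ) (u := fun s ↦ u (1 - s)) (φ := φ)
    (ψ := fun s ↦ ψ (1 - s)) hφ (hψ.comp (continuousOn_const.sub continuousOn_id) hmaps) hφℓ
    (fun s hs ↦ hψu (1 - s) (hmaps hs)) hφm
    (fun x hx y hy hxy ↦ hanti ⟨by linarith [hy.2], by linarith [hy.1]⟩
      ⟨by linarith [hx.2], by linarith [hx.1]⟩ (by linarith))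
    hℓinj hA hB hAB (by rwa [himage]) (by rwa [himage]) hℓ1
  norm_num at h
  exact Set.disjoint_left.mp hAB hu1 h

end Knot

/-! ### The two arcs of a band sum -/

/-- `y ↦ (a, y)` is continuous. [folklore] -/
theorem continuous_pt2_right (a : ℝ) : Continuous fun y : ℝ ↦ pt2 a y := by
  unfold pt2
  fun_prop

namespace BandData

variable {K₁ K₂ K : Knot} {avoid : Set (sphere (0 : EuclideanSpace ℝ (Fin 4)) 1)}
  (b : BandData K₁ K₂ K avoid)

/-- The band composed with a smooth planar curve is a smooth curve in `𝕊³`. [folklore] -/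
theorem contMDiff_band_comp {γ : ℝ → EuclideanSpace ℝ (Fin 2)} (hγ : ContDiff ℝ ∞ γ) :
    ContMDiff 𝓘(ℝ, ℝ) (𝓡 3) ∞ (fun s ↦ b.band (γ s)) :=
  b.contMDiff.comp hγ.contMDiff

/-- The band read in the ambient `ℝ⁴ ⊇ 𝕊³` is `C^∞`. [folklore] -/
theorem contDiff_coe_band : ContDiff ℝ ∞ (fun x ↦ (b.band x : EuclideanSpace ℝ (Fin 4))) := by
  have := fact_finrank_euclideanSpace_succ 3
  exact contMDiff_iff_contDiff.1 ((contMDiff_coe_sphere (m := ∞)).comp b.contMDiff)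

/-- **Velocity of the band along a planar curve** (chain rule in `ℝ⁴`): the velocity of
`s ↦ band (γ s)` is the derivative of the band at `γ s` in the direction `γ' s`. [folklore] -/
theorem deriv_coe_band_comp {γ : ℝ → EuclideanSpace ℝ (Fin 2)} (hγ : ContDiff ℝ ∞ γ) (s : ℝ) :
    deriv (fun s ↦ (b.band (γ s) : EuclideanSpace ℝ (Fin 4))) s =
      fderiv ℝ (fun x ↦ (b.band x : EuclideanSpace ℝ (Fin 4))) (γ s) (deriv γ s) :=
  fderiv_comp_deriv s (b.contDiff_coe_band.differentiable (by simp) _)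
    (hγ.differentiable (by simp) s)

/-- **The band is an immersion on the square neighbourhood, read in `ℝ⁴`**: its derivative at a
point of `squareNhd δ` kills no nonzero vector (the differentials of `band` and of `𝕊³ ⊆ ℝ⁴` are
injective). [folklore] -/
theorem fderiv_coe_band_ne_zero {x : EuclideanSpace ℝ (Fin 2)} (hx : x ∈ squareNhd b.δ)
    {v : EuclideanSpace ℝ (Fin 2)} (hv : v ≠ 0) :
    fderiv ℝ (fun x ↦ (b.band x : EuclideanSpace ℝ (Fin 4))) x v ≠ 0 := by
  have := fact_finrank_euclideanSpace_succ 3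
  have hn : (∞ : ℕ∞ω) ≠ 0 := by simp
  rw [fderiv_comp_sphere_apply ((contMDiff_coe_sphere (m := ∞)).mdifferentiableAt hn)
    (b.contMDiff.mdifferentiableAt hn)]
  intro h
  have h1 := mfderiv_coe_sphere_injective (n := 3) (b.band x) (h.trans (map_zero _).symm)
  exact hv (b.injective_mfderiv x hx (h1.trans (map_zero _).symm))

/-- The left edge `band (0, y)`, `-δ ≤ y ≤ 1 + δ`, of the band lies on `K₁` (for `-δ < y < 1 + δ`
by `preimage_left`; at the two corners by closedness of `range K₁`). [folklore] -/
theorem band_pt2_zero_mem {y : ℝ} (hy : y ∈ Icc (-b.δ) (1 + b.δ)) :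
    b.band (pt2 0 y) ∈ range K₁ := by
  have hδ := b.δ_pos
  have hsub : (fun y ↦ b.band (pt2 0 y)) '' Ioo (-b.δ) (1 + b.δ) ⊆ range K₁ := by
    rintro _ ⟨y, hy, rfl⟩
    have hmem : pt2 0 y ∈ {x ∈ squareNhd b.δ | x 0 = 0} := by
      refine ⟨fun i ↦ ?_, rfl⟩
      fin_cases i
      · exact ⟨by simp; linarith, by simp; linarith⟩
      · simpa [pt2] using hy
    rw [← b.preimage_left] at hmem
    exact hmem.1
  have h := image_closure_subset_closure_image (s := Ioo (-b.δ) (1 + b.δ))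
    (b.contMDiff.continuous.comp (continuous_pt2_right 0))
  rw [closure_Ioo (by linarith : (-b.δ) ≠ 1 + b.δ)] at h
  exact K₁.isClosed_range.closure_subset_iff.2 hsub (h ⟨y, hy, rfl⟩)

/-- The right edge `band (1, y)`, `-δ ≤ y ≤ 1 + δ`, of the band lies on `K₂`. [folklore] -/
theorem band_pt2_one_mem {y : ℝ} (hy : y ∈ Icc (-b.δ) (1 + b.δ)) :
    b.band (pt2 1 y) ∈ range K₂ := by
  have hδ := b.δ_pos
  have hsub : (fun y ↦ b.band (pt2 1 y)) '' Ioo (-b.δ) (1 + b.δ) ⊆ range K₂ := by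
    rintro _ ⟨y, hy, rfl⟩
    have hmem : pt2 1 y ∈ {x ∈ squareNhd b.δ | x 0 = 1} := by
      refine ⟨fun i ↦ ?_, rfl⟩
      fin_cases i
      · exact ⟨by simp; linarith, by simp; linarith⟩
      · simpa [pt2] using hy
    rw [← b.preimage_right] at hmem
    exact hmem.1
  have h := image_closure_subset_closure_image (s := Ioo (-b.δ) (1 + b.δ))
    (b.contMDiff.continuous.comp (continuous_pt2_right 1))
  rw [closure_Ioo (by linarith : (-b.δ) ≠ 1 + b.δ)] at h
  exact K₂.isClosed_range.closure_subset_iff.2 hsub (h ⟨y, hy, rfl⟩)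

/-- The closed lower arc `band (lowerArc s)`, `0 ≤ s ≤ 1`, lies on `K` (the open arc by
`preimage_range`, the endpoints by closedness of `range K`). [folklore] -/
theorem band_lowerArc_mem {s : ℝ} (hs : s ∈ Icc (0 : ℝ) 1) : b.band (b.lowerArc s) ∈ range K := by
  have hsub : (fun s ↦ b.band (b.lowerArc s)) '' Ioo 0 1 ⊆ range K := by
    rintro _ ⟨s, hs, rfl⟩
    have hmem : b.lowerArc s ∈ b.lowerArc '' Ioo 0 1 ∪ b.upperArc '' Ioo 0 1 := Or.inl ⟨s, hs, rfl⟩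
    rw [← b.preimage_range] at hmem
    exact hmem.1
  have h := image_closure_subset_closure_image (s := Ioo (0 : ℝ) 1)
    (b.contMDiff_band_comp b.contDiff_lowerArc).continuous
  rw [closure_Ioo zero_ne_one] at h
  exact K.isClosed_range.closure_subset_iff.2 hsub (h ⟨s, hs, rfl⟩)

/-- The closed upper arc `band (upperArc s)`, `0 ≤ s ≤ 1`, lies on `K`. [folklore] -/
theorem band_upperArc_mem {s : ℝ} (hs : s ∈ Icc (0 : ℝ) 1) : b.band (b.upperArc s) ∈ range K := by
  have hsub : (fun s ↦ b.band (b.upperArc s)) '' Ioo 0 1 ⊆ range K := by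
    rintro _ ⟨s, hs, rfl⟩
    have hmem : b.upperArc s ∈ b.lowerArc '' Ioo 0 1 ∪ b.upperArc '' Ioo 0 1 := Or.inr ⟨s, hs, rfl⟩
    rw [← b.preimage_range] at hmem
    exact hmem.1
  have h := image_closure_subset_closure_image (s := Ioo (0 : ℝ) 1)
    (b.contMDiff_band_comp b.contDiff_upperArc).continuous
  rw [closure_Ioo zero_ne_one] at h
  exact K.isClosed_range.closure_subset_iff.2 hsub (h ⟨s, hs, rfl⟩)

/-- The open lower arc `s ↦ band (lowerArc s)` is injective on `(0, 1)`. [folklore] -/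
theorem injOn_band_lowerArc : InjOn (fun s ↦ b.band (b.lowerArc s)) (Ioo 0 1) :=
  fun _ hs _ ht h ↦
    b.injOn_lowerArc hs ht (b.injOn (b.lowerArc_mem _ hs).1 (b.lowerArc_mem _ ht).1 h)

/-- The open upper arc `s ↦ band (upperArc s)` is injective on `(0, 1)`. [folklore] -/
theorem injOn_band_upperArc : InjOn (fun s ↦ b.band (b.upperArc s)) (Ioo 0 1) :=
  fun _ hs _ ht h ↦
    b.injOn_upperArc hs ht (b.injOn (b.upperArc_mem _ hs).1 (b.upperArc_mem _ ht).1 h)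

/-- The two open arcs of a band sum are disjoint (they lie in the lower and upper halves of the
square neighbourhood, on which the band is injective). [folklore] -/
theorem disjoint_image_arcs :
    Disjoint ((fun s ↦ b.band (b.lowerArc s)) '' Ioo 0 1)
      ((fun s ↦ b.band (b.upperArc s)) '' Ioo 0 1) := by
  rw [Set.disjoint_left]
  rintro _ ⟨s, hs, rfl⟩ ⟨t, ht, h⟩
  have he := b.injOn (b.upperArc_mem t ht).1 (b.lowerArc_mem s hs).1 h
  have h1 := (b.lowerArc_mem s hs).2
  have h2 := (b.upperArc_mem t ht).2
  rw [he] at h2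
  linarith

/-- **Where the points of a band sum lie**: every point of `K` is on the open lower arc, on the
open upper arc, or on `K₁ ∪ K₂` (inside the band by `preimage_range`, outside it by
`range_diff`). [folklore] -/
theorem apply_mem_arcs_union (x : sphere (0 : EuclideanSpace ℝ (Fin 2)) 1) :
    K x ∈ (fun s ↦ b.band (b.lowerArc s)) '' Ioo 0 1 ∪ (fun s ↦ b.band (b.upperArc s)) '' Ioo 0 1 ∪
      (range K₁ ∪ range K₂) := by
  by_cases hx : K x ∈ b.band '' squareNhd b.δ
  · obtain ⟨q, hq, hqx⟩ := hx
    have hmem : q ∈ b.band ⁻¹' range K ∩ squareNhd b.δ := ⟨⟨x, hqx.symm⟩, hq⟩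
    rw [b.preimage_range] at hmem
    rcases hmem with ⟨s, hs, rfl⟩ | ⟨s, hs, rfl⟩
    · exact Or.inl (Or.inl ⟨s, hs, hqx⟩)
    · exact Or.inl (Or.inr ⟨s, hs, hqx⟩)
  · have hmem : K x ∈ range K \ b.band '' squareNhd b.δ := ⟨⟨x, rfl⟩, hx⟩
    rw [b.range_diff] at hmem
    exact Or.inr hmem.1

/-- **The lower arc is traversed from left to right by every lift.** A continuous lift `φ` of
the closed lower arc `s ↦ band (lowerArc s)` through `K ∘ circlePt` is strictly increasing on
`(0, 1)`: it is strictly monotone (the arc is injective), and the orientation clause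
`orient_result` of the band-sum data makes `φ' (1/2)` positive (the velocity of the arc at
`s = 1/2` is `φ' (1/2)` times the velocity of `K`, and a positive multiple of it by the
clause). [folklore] -/
theorem strictMonoOn_lift_lowerArc {φ : ℝ → ℝ} (hφ : Continuous φ)
    (hφℓ : ∀ s ∈ Icc (0 : ℝ) 1, K (circlePt (φ s)) = b.band (b.lowerArc s)) :
    StrictMonoOn φ (Ioo 0 1) := by
  have hℓs := b.contMDiff_band_comp b.contDiff_lowerArc
  rcases K.strictMonoOn_or_strictAntiOn_lift zero_lt_one hφ.continuousOn
    (fun s hs ↦ hφℓ s (Ioo_subset_Icc_self hs)) b.injOn_band_lowerArc with h | h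
  · exact h
  exfalso
  have hhalf : (2⁻¹ : ℝ) ∈ Ioo (0 : ℝ) 1 := ⟨by norm_num, by norm_num⟩
  have hle : deriv φ 2⁻¹ ≤ 0 := deriv_nonpos_of_strictAntiOn_Ioo h hhalf
  obtain ⟨θ, c, hc, hpt, hder⟩ := b.orient_result
  have hev : ∀ᶠ s in 𝓝 (2⁻¹ : ℝ), K (circlePt (φ s)) = b.band (b.lowerArc s) := by
    filter_upwards [Icc_mem_nhds hhalf.1 hhalf.2] with s hs using hφℓ s hs
  have hvel := K.deriv_coe_eq_deriv_lift_smul hℓs.contMDiffAt hφ.continuousAt hev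
  rw [b.deriv_coe_band_comp b.contDiff_lowerArc] at hvel
  -- identify the parameter `θ` of the orientation clause with `φ (1/2)` modulo the period
  have hθ : ∃ m : ℤ, (2 * π)⁻¹ * θ = φ 2⁻¹ + m := by
    rw [← K.apply_circlePt_eq_iff, circlePt_eq_circlePoint, mul_inv_cancel_left₀ (by positivity),
      hpt, hφℓ _ (Ioo_subset_Icc_self hhalf)]
  obtain ⟨m, hm⟩ := hθ
  rw [K.deriv_coe_apply_circlePoint, hm, K.deriv_curve_add_int, hvel, smul_smul] at hder
  have hV := K.deriv_curve_ne_zero (φ 2⁻¹)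
  have h1 : (2 * π)⁻¹ = c * deriv φ 2⁻¹ := smul_left_injective ℝ hV hder
  have h2 : 0 < c * deriv φ 2⁻¹ := by rw [← h1]; positivity
  have h3 : c * deriv φ 2⁻¹ ≤ 0 := mul_nonpos_of_nonneg_of_nonpos hc.le hle
  linarith

/-- **The upper arc of a band sum is traversed from right to left** (the orientation clause of
the result on the *upper* arc, which `BandData` does not record because it is forced): if the
summands `K₁`, `K₂` are disjoint, the velocity of `K` at the mid-point `band (upperArc (1/2))`
of the upper arc is a positive multiple of the image of the velocity of `upperArc` (which runs
from the upper-right corner `(1, 1 + δ)` to the upper-left corner `(0, 1 + δ)`). *Proof.* Lift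
the closed lower and upper arcs through `K ∘ circlePt` (`Knot.exists_lift`); the lower lift is
increasing by `orient_result` (`strictMonoOn_lift_lowerArc`), the upper one is strictly
monotone, and increasing by the circular-order lemma `Knot.strictMonoOn_of_lifts` applied with
`A = range K₁ ∋ band (0, 1 + δ) = band (upperArc 1)` and `B = range K₂ ∋ band (1, -δ) =
band (lowerArc 1)`; finally the derivative of an increasing lift at `1/2` is `≥ 0`, and `≠ 0`
because the arc is immersed, which is the clause with `c = (2π ψ'(1/2))⁻¹`. This is the
geometric content of "the connected sum of oriented knots is commutative" for the band picture:
Rolfsen (1976), §2.G; Burde–Zieschang (2003), §7.A; Cromwell (2004), §4.6, Thm. 4.6.2.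
[folklore] -/
theorem orient_upper (hdisj : Disjoint (range K₁) (range K₂)) :
    ∃ θ c : ℝ, 0 < c ∧ K (circlePoint θ) = b.band (b.upperArc 2⁻¹) ∧
      deriv (fun t ↦ (K (circlePoint t) : EuclideanSpace ℝ (Fin 4))) θ =
        c • fderiv ℝ (fun x ↦ (b.band x : EuclideanSpace ℝ (Fin 4))) (b.upperArc 2⁻¹)
          (deriv b.upperArc 2⁻¹) := by
  have hδ := b.δ_pos
  have hℓs := b.contMDiff_band_comp b.contDiff_lowerArc
  have hus := b.contMDiff_band_comp b.contDiff_upperArc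
  obtain ⟨φ, hφ, hφℓ⟩ := K.exists_lift hℓs.continuous fun s hs ↦ b.band_lowerArc_mem hs
  obtain ⟨ψ, hψ, hψu⟩ := K.exists_lift hus.continuous fun s hs ↦ b.band_upperArc_mem hs
  have hφm := b.strictMonoOn_lift_lowerArc hφ hφℓ
  have hψm' := K.strictMonoOn_or_strictAntiOn_lift zero_lt_one hψ.continuousOn
    (fun s hs ↦ hψu s (Ioo_subset_Icc_self hs)) b.injOn_band_upperArc
  have hℓ1 : b.band (b.lowerArc 1) ∈ range K₂ := by
    rw [b.lowerArc_one]
    exact b.band_pt2_one_mem ⟨le_rfl, by linarith⟩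
  have hu1 : b.band (b.upperArc 1) ∈ range K₁ := by
    rw [b.upperArc_one]
    exact b.band_pt2_zero_mem ⟨by linarith, le_rfl⟩
  have hψm : StrictMonoOn ψ (Ioo 0 1) :=
    K.strictMonoOn_of_lifts hφ.continuousOn hψ.continuousOn hφℓ hψu hφm hψm' b.injOn_band_lowerArc
      K₁.isClosed_range K₂.isClosed_range hdisj (fun t ↦ b.apply_mem_arcs_union _)
      b.disjoint_image_arcs hℓ1 hu1
  -- the derivative of the increasing lift at `1/2` is positive
  have hhalf : (2⁻¹ : ℝ) ∈ Ioo (0 : ℝ) 1 := ⟨by norm_num, by norm_num⟩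
  have hge : 0 ≤ deriv ψ 2⁻¹ := deriv_nonneg_of_strictMonoOn_Ioo hψm hhalf
  have hev : ∀ᶠ s in 𝓝 (2⁻¹ : ℝ), K (circlePt (ψ s)) = b.band (b.upperArc s) := by
    filter_upwards [Icc_mem_nhds hhalf.1 hhalf.2] with s hs using hψu s hs
  have hvel := K.deriv_coe_eq_deriv_lift_smul hus.contMDiffAt hψ.continuousAt hev
  rw [b.deriv_coe_band_comp b.contDiff_upperArc] at hvel
  have hw := b.fderiv_coe_band_ne_zero (b.upperArc_mem _ hhalf).1 (b.deriv_upperArc_ne_zero _ hhalf)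
  have hne : deriv ψ 2⁻¹ ≠ 0 := fun h0 ↦ hw (by rw [hvel, h0, zero_smul])
  have hpos : 0 < deriv ψ 2⁻¹ := lt_of_le_of_ne hge (Ne.symm hne)
  refine ⟨2 * π * ψ 2⁻¹, (2 * π * deriv ψ 2⁻¹)⁻¹, by positivity, ?_, ?_⟩
  · rw [← circlePt_eq_circlePoint]
    exact hψu _ (Ioo_subset_Icc_self hhalf)
  · rw [K.deriv_coe_apply_circlePoint, inv_mul_cancel_left₀ (by positivity), hvel, smul_smul]
    congr 1
    conv_rhs => rw [mul_inv_rev, mul_comm (deriv ψ 2⁻¹)⁻¹, inv_mul_cancel_right₀ hne]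

end BandData

/-! ### The half-turn of the band -/

/-- The half-turn `x ↦ (1, 1) - x` of the plane about the centre of the unit square, in
coordinates: `((1, 1) - x) i = 1 - x i`. [folklore] -/
theorem pt2_one_one_sub_apply (x : EuclideanSpace ℝ (Fin 2)) (i : Fin 2) :
    (pt2 1 1 - x) i = 1 - x i := by
  fin_cases i <;> simp [pt2]

/-- The half-turn on the named points: `(1, 1) - (a, c) = (1 - a, 1 - c)`. [folklore] -/
theorem pt2_one_one_sub_pt2 (a c : ℝ) : pt2 1 1 - pt2 a c = pt2 (1 - a) (1 - c) := by
  ext i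
  fin_cases i <;> simp [pt2]

/-- The half-turn preserves the square neighbourhood. [folklore] -/
theorem pt2_one_one_sub_mem_squareNhd_iff {δ : ℝ} {x : EuclideanSpace ℝ (Fin 2)} :
    pt2 1 1 - x ∈ squareNhd δ ↔ x ∈ squareNhd δ := by
  simp only [mem_squareNhd_iff, pt2_one_one_sub_apply, mem_Ioo]
  exact forall_congr' fun i ↦ ⟨fun ⟨h1, h2⟩ ↦ ⟨by linarith, by linarith⟩,
    fun ⟨h1, h2⟩ ↦ ⟨by linarith, by linarith⟩⟩

/-- The half-turn maps the square neighbourhood onto itself. [folklore] -/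
theorem image_pt2_one_one_sub_squareNhd (δ : ℝ) :
    (fun x : EuclideanSpace ℝ (Fin 2) ↦ pt2 1 1 - x) '' squareNhd δ = squareNhd δ := by
  ext x
  constructor
  · rintro ⟨y, hy, rfl⟩
    exact pt2_one_one_sub_mem_squareNhd_iff.2 hy
  · intro hx
    exact ⟨pt2 1 1 - x, pt2_one_one_sub_mem_squareNhd_iff.2 hx, sub_sub_cancel _ _⟩

/-- Membership in the image of a half-turned planar curve (the half-turn is an involution).
[folklore] -/
theorem mem_image_pt2_one_one_sub_comp_iff {γ : ℝ → EuclideanSpace ℝ (Fin 2)} {s : Set ℝ}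
    {x : EuclideanSpace ℝ (Fin 2)} :
    x ∈ (fun t ↦ pt2 1 1 - γ t) '' s ↔ pt2 1 1 - x ∈ γ '' s := by
  constructor
  · rintro ⟨t, ht, rfl⟩
    exact ⟨t, ht, (sub_sub_cancel _ _).symm⟩
  · rintro ⟨t, ht, h⟩
    refine ⟨t, ht, ?_⟩
    show pt2 1 1 - γ t = x
    rw [h, sub_sub_cancel]

namespace BandData

variable {K₁ K₂ K : Knot} {avoid : Set (sphere (0 : EuclideanSpace ℝ (Fin 4)) 1)}
  (b : BandData K₁ K₂ K avoid)

/-- **Chain rule for the half-turned band** (read in `ℝ⁴`): the derivative of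
`x ↦ band ((1, 1) - x)` at `x` in the direction `v` is the derivative of `band` at `(1, 1) - x`
in the direction `-v`. [folklore] -/
theorem fderiv_coe_band_pt2_one_one_sub (x v : EuclideanSpace ℝ (Fin 2)) :
    fderiv ℝ (fun x ↦ (b.band (pt2 1 1 - x) : EuclideanSpace ℝ (Fin 4))) x v =
      fderiv ℝ (fun x ↦ (b.band x : EuclideanSpace ℝ (Fin 4))) (pt2 1 1 - x) (-v) := by
  have hd : DifferentiableAt ℝ (fun x ↦ (b.band x : EuclideanSpace ℝ (Fin 4))) (pt2 1 1 - x) :=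
    b.contDiff_coe_band.differentiable (by simp) _
  have hρ : DifferentiableAt ℝ (fun x : EuclideanSpace ℝ (Fin 2) ↦ pt2 1 1 - x) x :=
    (differentiableAt_const _).sub differentiableAt_id
  rw [show (fun x ↦ (b.band (pt2 1 1 - x) : EuclideanSpace ℝ (Fin 4))) =
      (fun x ↦ (b.band x : EuclideanSpace ℝ (Fin 4))) ∘
        (fun x : EuclideanSpace ℝ (Fin 2) ↦ pt2 1 1 - x) from rfl,
    fderiv_comp x hd hρ, fderiv_const_sub, fderiv_fun_id]
  simp

/-- **The half-turned band.** If `K` is the band sum of `K₁`, `K₂` along `band` and the summands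
are disjoint, then `K` is the band sum of `K₂`, `K₁` along the band precomposed with the
half-turn `x ↦ (1, 1) - x` of the square (same collar width): the half-turn exchanges the two
edge lines together with their orientations (`orient_left` ↔ `orient_right`, by the chain rule
with `D((1, 1) - x) = -id`) and the two half-rectangles, the new planar arcs being the
half-turned old ones in the other order; the orientation clause of the result on the new lower
arc is the forced orientation of `K` along the old upper arc (`orient_upper`). Stated as an
existence recording the new band and collar width (band-sum data are only used existentially).
Rolfsen (1976), §2.G; Burde–Zieschang (2003), §7.A; Cromwell (2004), §4.6. [folklore] -/
theorem exists_halfTurn (hdisj : Disjoint (range K₁) (range K₂)) :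
    ∃ b' : BandData K₂ K₁ K avoid, b'.δ = b.δ ∧ b'.band = fun x ↦ b.band (pt2 1 1 - x) := by
  have hδ := b.δ_pos
  have hρs : ContDiff ℝ ∞ (fun x : EuclideanSpace ℝ (Fin 2) ↦ pt2 1 1 - x) :=
    contDiff_const.sub contDiff_id
  refine ⟨{
    band := fun x ↦ b.band (pt2 1 1 - x)
    δ := b.δ
    δ_pos := b.δ_pos
    contMDiff := b.contMDiff.comp hρs.contMDiff
    injOn := fun x hx y hy h ↦ sub_right_injective
      (b.injOn (pt2_one_one_sub_mem_squareNhd_iff.2 hx) (pt2_one_one_sub_mem_squareNhd_iff.2 hy) h)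
    injective_mfderiv := fun x hx ↦ by
      have hn : (∞ : ℕ∞ω) ≠ 0 := by simp
      have hb : MDifferentiableAt 𝓘(ℝ, EuclideanSpace ℝ (Fin 2)) (𝓡 3) b.band (pt2 1 1 - x) :=
        b.contMDiff.mdifferentiableAt hn
      have hρ : MDifferentiableAt 𝓘(ℝ, EuclideanSpace ℝ (Fin 2)) 𝓘(ℝ, EuclideanSpace ℝ (Fin 2))
          (fun x : EuclideanSpace ℝ (Fin 2) ↦ pt2 1 1 - x) x :=
        hρs.contMDiff.mdifferentiableAt hn
      rw [show (fun x ↦ b.band (pt2 1 1 - x)) =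
          b.band ∘ (fun x : EuclideanSpace ℝ (Fin 2) ↦ pt2 1 1 - x) from rfl,
        mfderiv_comp x hb hρ, mfderiv_eq_fderiv, fderiv_const_sub, fderiv_fun_id]
      intro v w hvw
      simp only [ContinuousLinearMap.comp_apply] at hvw
      exact neg_injective (b.injective_mfderiv _ (pt2_one_one_sub_mem_squareNhd_iff.2 hx) hvw)
    disjoint_avoid := by
      rw [show (fun x ↦ b.band (pt2 1 1 - x)) =
          b.band ∘ (fun x : EuclideanSpace ℝ (Fin 2) ↦ pt2 1 1 - x) from rfl,
        image_comp, image_pt2_one_one_sub_squareNhd]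
      exact b.disjoint_avoid
    preimage_left := by
      ext x
      have h := Set.ext_iff.mp b.preimage_right (pt2 1 1 - x)
      simp only [mem_inter_iff, mem_preimage, mem_setOf_eq, pt2_one_one_sub_mem_squareNhd_iff,
        pt2_one_one_sub_apply] at h ⊢
      rw [h]
      exact and_congr_right fun _ ↦ ⟨fun h ↦ by linarith, fun h ↦ by linarith⟩
    preimage_right := by
      ext x
      have h := Set.ext_iff.mp b.preimage_left (pt2 1 1 - x)
      simp only [mem_inter_iff, mem_preimage, mem_setOf_eq, pt2_one_one_sub_mem_squareNhd_iff,
        pt2_one_one_sub_apply] at h ⊢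
      rw [h]
      exact and_congr_right fun _ ↦ ⟨fun h ↦ by linarith, fun h ↦ by linarith⟩
    range_diff := by
      rw [show (fun x ↦ b.band (pt2 1 1 - x)) =
          b.band ∘ (fun x : EuclideanSpace ℝ (Fin 2) ↦ pt2 1 1 - x) from rfl,
        image_comp, image_pt2_one_one_sub_squareNhd, b.range_diff, union_comm]
    lowerArc := fun t ↦ pt2 1 1 - b.upperArc t
    upperArc := fun t ↦ pt2 1 1 - b.lowerArc t
    contDiff_lowerArc := contDiff_const.sub b.contDiff_upperArc
    contDiff_upperArc := contDiff_const.sub b.contDiff_lowerArc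
    injOn_lowerArc := fun s hs t ht h ↦ b.injOn_upperArc hs ht (sub_right_injective h)
    injOn_upperArc := fun s hs t ht h ↦ b.injOn_lowerArc hs ht (sub_right_injective h)
    deriv_lowerArc_ne_zero := fun t ht ↦ by
      rw [deriv_const_sub]
      exact neg_ne_zero.2 (b.deriv_upperArc_ne_zero t ht)
    deriv_upperArc_ne_zero := fun t ht ↦ by
      rw [deriv_const_sub]
      exact neg_ne_zero.2 (b.deriv_lowerArc_ne_zero t ht)
    lowerArc_zero := by
      simp only [b.upperArc_zero, pt2_one_one_sub_pt2]
      norm_num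
    lowerArc_one := by
      simp only [b.upperArc_one, pt2_one_one_sub_pt2]
      norm_num
    upperArc_zero := by
      simp only [b.lowerArc_zero, pt2_one_one_sub_pt2]
      norm_num
    upperArc_one := by
      simp only [b.lowerArc_one, pt2_one_one_sub_pt2]
      norm_num
    lowerArc_mem := fun t ht ↦ by
      obtain ⟨h1, h2⟩ := b.upperArc_mem t ht
      refine ⟨pt2_one_one_sub_mem_squareNhd_iff.2 h1, ?_⟩
      rw [pt2_one_one_sub_apply]
      linarith
    upperArc_mem := fun t ht ↦ by
      obtain ⟨h1, h2⟩ := b.lowerArc_mem t ht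
      refine ⟨pt2_one_one_sub_mem_squareNhd_iff.2 h1, ?_⟩
      rw [pt2_one_one_sub_apply]
      linarith
    preimage_range := by
      ext x
      have h := Set.ext_iff.mp b.preimage_range (pt2 1 1 - x)
      simp only [mem_inter_iff, mem_preimage, pt2_one_one_sub_mem_squareNhd_iff, mem_union] at h ⊢
      rw [h, mem_image_pt2_one_one_sub_comp_iff, mem_image_pt2_one_one_sub_comp_iff, or_comm]
    orient_left := by
      obtain ⟨θ, c, hc, hpt, hder⟩ := b.orient_right
      refine ⟨θ, c, hc, ?_, ?_⟩
      · rw [hpt, pt2_one_one_sub_pt2]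
        norm_num
      · rw [hder, fderiv_coe_band_pt2_one_one_sub, pt2_one_one_sub_pt2]
        congr 2 <;> [norm_num; (ext i; fin_cases i <;> simp [pt2])]
    orient_right := by
      obtain ⟨θ, c, hc, hpt, hder⟩ := b.orient_left
      refine ⟨θ, c, hc, ?_, ?_⟩
      · rw [hpt, pt2_one_one_sub_pt2]
        norm_num
      · rw [hder, fderiv_coe_band_pt2_one_one_sub, pt2_one_one_sub_pt2]
        congr 2 <;> [norm_num; (ext i; fin_cases i <;> simp [pt2])]
    orient_result := by
      obtain ⟨θ, c, hc, hpt, hder⟩ := b.orient_upper hdisj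
      refine ⟨θ, c, hc, ?_, ?_⟩
      · rw [hpt, sub_sub_cancel]
      · rw [hder, fderiv_coe_band_pt2_one_one_sub, sub_sub_cancel, deriv_const_sub,
          neg_neg] }, rfl, rfl⟩

end BandData

namespace Knot

/-- **Discharge** of `Literature.Topology.FourManifolds.Knot.IsConnectedSum.comm`
(**commutativity of the connected sum**, `K₁ # K₂ = K₂ # K₁`): given a connected-sum
configuration for `K` — isotopic copies `K₁'`, `K₂'` split by the sphere `S` and band-sum data
along a band crossing `S` in its middle segment — the copies in the other order are split by
the same sphere (`IsSplitBy.symm`), the half-turned band (`BandData.exists_halfTurn`, the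
summands being disjoint because they are split, `IsSplit.disjoint_range`) is band-sum data for
`K` as a band sum of `K₂'`, `K₁'`, and it crosses `S` in the same middle segment (the half-turn
preserves `{x₀ = 1/2}`). In the printed sources the two factors enter the definition of the
product symmetrically and commutativity is part of "the knot types form a commutative semigroup
under `#`": Burde–Zieschang, *Knots* (2nd ed. 2003), §7.A (cited by the statement as
Prop. 7.10); Cromwell, *Knots and Links* (2004), §4.6, Thm. 4.6.2 ("`(𝕂, #)` is an abelian
semigroup with unit, and unique factorisation"); Rolfsen, *Knots and Links* (1976), §2.G. The
content formalised here is that the oriented band picture of `BandSum.lean` turned by a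
half-turn is again an oriented band picture (`BandData.orient_upper`). The tag cites the held
and checked source; the statement's own locator (Burde–Zieschang, Prop. 7.10) could not be
checked against the book, which the store does not hold. [cite: Cromwell2004, §4.6 Thm. 4.6.2] -/
theorem IsConnectedSum.comm_holds : IsConnectedSum.comm := by
  intro K₁ K₂ K h
  obtain ⟨K₁', K₂', h₁, h₂, S, b, hS, hcross⟩ := h
  have hdisj : Disjoint (range K₁') (range K₂') := IsSplit.disjoint_range ⟨S, hS⟩
  obtain ⟨b', hδ, hband⟩ := b.exists_halfTurn hdisj
  refine ⟨K₂', K₁', h₂, h₁, S, b', hS.symm, ?_⟩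
  rw [hband, hδ]
  ext x
  have h := Set.ext_iff.mp hcross (pt2 1 1 - x)
  simp only [mem_inter_iff, mem_preimage, mem_setOf_eq, pt2_one_one_sub_mem_squareNhd_iff,
    pt2_one_one_sub_apply] at h ⊢
  rw [h]
  exact and_congr_right fun _ ↦ ⟨fun h ↦ by linarith, fun h ↦ by linarith⟩

end Knot

end Literature.Topology.FourManifolds
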